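/-
Copyright (c) 2026 the pub-hodgecm-mathlib formalisation cell (harness21).  Prover seat hodgecm-mathlib-LH4-p13 (g8), req620 Track A «(D-RAM) FOUR-FRAME» squad, tier 0,
STAGE-1b (dealer LH4-plan (g13) WORD #66 (3); LH4-p05 (g8) ★ p859970 DEFS LEAF №7 `CleanLabelDichotomyLawAt` (A″), producer LH4-p13): brick (L-lab-18) «(A″) AT THE RECORD
LETTERS»: the transport Γ_b-vertex → unimodular diagonal model (★ p855032 frame) → normalised HNF model (★ normalisation section + ★ HNF existence) that turns ★ (L-lab-17c)'s
S-diagonal triple and ★ (L-lab-16)'s one-class theorem into `CleanLabelDichotomyLawAt N₀ mcOfRecord σ ϖ d t` above the fence, for every `d ≥ 2`, and its `DyadicFence` closure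
at `n0DerivedOfRecord`.  2026-09-04.
-/
import Summits.HodgeConjecture.HodgeConjecture.Theorems.F0P3cDyRamHNFDiagonalTriple           -- ★ (this seat, (L-lab-17c)): `exists_triple_of_clean_shell_latt_hnf`; brings 17a∕17b, ★ `dualisable_strata`, ★ p859653
import Summits.HodgeConjecture.HodgeConjecture.Theorems.F0P3cDyRamCleanShellOneClass           -- ★ p860136 (this seat, (L-lab-16)): `exists_class_setOf_modelValue_eq_of_triple_of_isVertexLattice`
import Summits.HodgeConjecture.HodgeConjecture.Theorems.F0P3cDyRamCleanLabelDefs               -- ★ p859970 DEFS LEAF №7 (LH4-p05 (g8)): `CleanLabelDichotomyLawAt`; brings ★ №6 `n0DerivedOfRecord`, ★ №5 `mcOfRecord`, ★ №1 `DyadicFence`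
import Summits.HodgeConjecture.HodgeConjecture.Theorems.F0P3cDyRamDiagonalVertexTranslate     -- ★ (LH4-p10): `isVertexLattice_diagonal_mapGL_diagonal`
import Summits.HodgeConjecture.HodgeConjecture.Theorems.F0P3cDyRamDiagonalNormalisedSection    -- ★ TARGET J (LH4-p10): `existsUnique_zpow_diagonal_normalised`, `exists_gl_coe_eq_diagonal_zpow`
import Summits.HodgeConjecture.HodgeConjecture.Theorems.F0P3cDyRamDiagonalStableLatticeHNFExists -- ★ (D1) (LH4-p12): `exists_latt_eq_latt_hnf`
import Summits.HodgeConjecture.HodgeConjecture.Theorems.F0P3cDyRamDiagonalSelfDualFibre         -- ★ (LH4-p10): `coe_inv_diagonal`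
import Summits.HodgeConjecture.HodgeConjecture.Theorems.F0P3cDyRamDiagonalKappaCoreHangingClass -- ★ `two_le_d_of_v_two_lt_one` (dyadic datum ⇒ `d ≥ 2`)
import HarnessLib

/-!
# Crux `H413`, line LH4 «(D-RAM) FOUR-FRAME», STAGE-1b — (L-lab-18) «(A″) AT THE RECORD LETTERS: `CleanLabelDichotomyLawAt` PROVED FOR `d ≥ 2`»

Cell `hodgecm-mathlib` (D-0151), FLOOR 0, crux item H413 = `stmt-HodgeConjecture-24833`, route of record `HCCMUnconditional`; squad F0∕P3c∕LH4.  THEOREMS ONLY (no `def`, no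
instance, no notation, no `sorry`, default heartbeats), ★-only imports, lane `--supports stmt-HodgeConjecture-24833`.

* §1 `exists_mem_mapGL_diagonal_modelValue_iff` (the model value set of `diag(z)·M` for the translated form `diag(c_i∕N(z_i))` is that of `M` for `diag(c)`).
* §2 `exists_class_of_clean_shell_model` — at a `T = diag(α,β,1)`-fixed type-0 vertex `M` of a non-degenerate `σ`-fixed `diag(c)` on the clean shell `(d % 2, m_c)` with `d ≥ 2` and
  threshold `N₀ ≥ m_c = 2⌊(m*+d)∕2⌋`: the model value set at precision `m*` is `valueSetMod σ ϖ m* (e • X₊)` for a `σ`-fixed unit `e`.  Proof: normalise `M` by a diagonal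
  `ϖ`-power (★ TARGET J), present it in HNF (★ (D1)), read the translated polarisation (★ TARGET K), get the S-diagonal generating triple (★ (L-lab-17c)) and the class
  (★ (L-lab-16)), transport the value set back (§1).
* §3 HEAD **`cleanLabelDichotomyLawAt_of_fence`**: `2 ≤ d → mcOfRecord d ≤ N₀ d → CleanLabelDichotomyLawAt N₀ mcOfRecord σ ϖ d t` (Γ_b ↔ model by ★ p855032's unimodular frame and
  ★ p858764∕p859223 token transport); **`cleanLabelDichotomyLawAt_derived`** (`N₀ = n0DerivedOfRecord`, every `d ≥ 2`) and the tier-0 shape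
  **`dyadicFence_cleanLabelDichotomyLawAt_derived_ofRecord : ∀ σ ϖ d t, DyadicFence (CleanLabelDichotomyLawAt n0DerivedOfRecord mcOfRecord σ ϖ d t)`** (the fence `|2| < 1`
  supplies `d ≥ 2`, ★ `two_le_d_of_v_two_lt_one`).  DATA: at the tame class `d = 1` the bare Prop is FALSE (label-neither clean-shell vertices at `sqlev = m_c = 2`, engine cell t3 keys (3,3,5), (5,5,7), (3,3,7),
  LH4-p13 (g8) bus 12:3xZ) — hence the `2 ≤ d` ∕ `DyadicFence` guard is sharp.

HONEST LABEL: count-neutral until the pen cites it; (A″) PROVED at every dyadic datum; (β-BAL)∕(β)∕T₊ row OPEN.  HC_CM remains proved only modulo the printed citations (2 remaining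
named inputs: hLiu418 = `stmt-HodgeConjecture-24832`, h413 = `stmt-HodgeConjecture-24833`) until rung 0 closes.
-/

noncomputable section

namespace Summit.HodgeConjecture.HodgeConjecture.Cruxes.H413.F0P3cDyRamCleanLabelDichotomyOfRecord

open Literature.NumberTheory.Automorphic Literature.NumberTheory.Automorphic.HermitianLattice Literature.NumberTheory.Automorphic.UnitaryGroup
open Literature.NumberTheory.Automorphic.UnitaryLatticeTree Literature.NumberTheory.Automorphic.UnitaryThreeFourFrame
open Summit.HodgeConjecture.HodgeConjecture.Cruxes.H413.F0P3cDyRamFourFramePieces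
open Summit.HodgeConjecture.HodgeConjecture.Cruxes.H413.F0P3cDyRamFourFrameCensusDefs
open Summit.HodgeConjecture.HodgeConjecture.Cruxes.H413.F0P3cDyRamFourFrameLawDefs (DyadicFence dyadicFence_of)
open Summit.HodgeConjecture.HodgeConjecture.Cruxes.H413.F0P3cDyRamStageOneBDefs (mcOfRecord n0CleanOfRecord)
open Summit.HodgeConjecture.HodgeConjecture.Cruxes.H413.F0P3cDyRamStageOneBDerivedDefs (n0DerivedOfRecord mcOfRecord_le_n0DerivedOfRecord)
open Summit.HodgeConjecture.HodgeConjecture.Cruxes.H413.F0P3cDyRamCleanLabelDefs (CleanLabelDichotomyLawAt)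
open Summit.HodgeConjecture.HodgeConjecture.Cruxes.H413.F0P3cDyRamDiagonalTorusDefs
open Summit.HodgeConjecture.HodgeConjecture.Cruxes.H413.F0P3cDyRamFixedCountDiagonalModel (exists_unimodular_diagonal_frame)
open Summit.HodgeConjecture.HodgeConjecture.Cruxes.H413.F0P3cDyRamLevelCountDiagonalModel
open Summit.HodgeConjecture.HodgeConjecture.Cruxes.H413.F0P3cDyRamLabelCountDiagonalModel
open Summit.HodgeConjecture.HodgeConjecture.Cruxes.H413.F0P3cDyRamDiagonalVertexTranslate (isVertexLattice_diagonal_mapGL_diagonal)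
open Summit.HodgeConjecture.HodgeConjecture.Cruxes.H413.F0P3cDyRamDiagonalNormalisedSection (existsUnique_zpow_diagonal_normalised exists_gl_coe_eq_diagonal_zpow)
open Summit.HodgeConjecture.HodgeConjecture.Cruxes.H413.F0P3cDyRamDiagonalStableLatticeHNFExists (exists_latt_eq_latt_hnf)
open Summit.HodgeConjecture.HodgeConjecture.Cruxes.H413.F0P3cDyRamDiagonalSelfDualFibre (coe_inv_diagonal)
open Summit.HodgeConjecture.HodgeConjecture.Cruxes.H413.F0P3cDyRamUniformizerPowerTube (v_pow_eq_exp_neg)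
open Summit.HodgeConjecture.HodgeConjecture.Cruxes.H413.F0P3cDyRamCleanShellOneClass (exists_class_setOf_modelValue_eq_of_triple_of_isVertexLattice)
open Summit.HodgeConjecture.HodgeConjecture.Cruxes.H413.F0P3cDyRamHNFDiagonalTriple (exists_triple_of_clean_shell_latt_hnf)
open Summit.HodgeConjecture.HodgeConjecture.Cruxes.H413.F0P3cDyRamDiagonalKappaCoreHangingClass (two_le_d_of_v_two_lt_one)
open scoped Valued WithZero Matrix MatrixGroups
open WithZero

variable {K : Type} [Field K] [Valued K ℤᵐ⁰]

/-! ## §1  The model value set under a diagonal translate -/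

/-- **THE MODEL VALUE SET UNDER A DIAGONAL TRANSLATE.**  For `Z = diag(z)` (`z_i ≠ 0`) and any predicate `P`: «some `y ∈ Z·M` has `P(c₀N(z₀)⁻¹(α−1)N(y₀) + c₁N(z₁)⁻¹(β−1)N(y₁))`»
iff «some `y ∈ M` has `P(c₀(α−1)N(y₀) + c₁(β−1)N(y₁))`» (`y ↦ Z⁻¹y`). [cite: Jacobowitz1962, §7–§8] [cite: Serre1980Trees, II §1.1] -/
theorem exists_mem_mapGL_diagonal_modelValue_iff (σ : K →+* K) {z : Fin 3 → K} (hz : ∀ i, z i ≠ 0) (Z : GL (Fin 3) K)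
    (hZ : (Z : Matrix (Fin 3) (Fin 3) K) = Matrix.diagonal z) (c : Fin 3 → K) (α β : K) (M : Submodule 𝒪[K] (Fin 3 → K)) (P : K → Prop) :
    (∃ y ∈ mapGL Z M, P (c 0 * (z 0 * σ (z 0))⁻¹ * (α - 1) * (y 0 * σ (y 0)) + c 1 * (z 1 * σ (z 1))⁻¹ * (β - 1) * (y 1 * σ (y 1)))) ↔
      ∃ y ∈ M, P (c 0 * (α - 1) * (y 0 * σ (y 0)) + c 1 * (β - 1) * (y 1 * σ (y 1))) := by
  have hZinv := coe_inv_diagonal hz Z hZ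
  have hσz : ∀ i, σ (z i) ≠ 0 := fun i => (map_ne_zero σ).2 (hz i)
  constructor
  · rintro ⟨y, hy, hP⟩
    refine ⟨((Z⁻¹ : GL (Fin 3) K) : Matrix (Fin 3) (Fin 3) K) *ᵥ y, (mem_mapGL_iff Z M y).1 hy, ?_⟩
    have key : c 0 * (α - 1) * (((z 0)⁻¹ * y 0) * σ ((z 0)⁻¹ * y 0)) + c 1 * (β - 1) * (((z 1)⁻¹ * y 1) * σ ((z 1)⁻¹ * y 1)) =
        c 0 * (z 0 * σ (z 0))⁻¹ * (α - 1) * (y 0 * σ (y 0)) + c 1 * (z 1 * σ (z 1))⁻¹ * (β - 1) * (y 1 * σ (y 1)) := by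
      rw [map_mul, map_mul, map_inv₀, map_inv₀, mul_inv, mul_inv]; ring
    rw [hZinv]
    simp only [Matrix.mulVec_diagonal]
    rw [key]
    exact hP
  · rintro ⟨y, hy, hP⟩
    refine ⟨(Z : Matrix (Fin 3) (Fin 3) K) *ᵥ y, ?_, ?_⟩
    · rw [mem_mapGL_iff, Matrix.mulVec_mulVec, ← Units.val_mul, inv_mul_cancel, Units.val_one, Matrix.one_mulVec]
      exact hy
    · have key : c 0 * (z 0 * σ (z 0))⁻¹ * (α - 1) * ((z 0 * y 0) * σ (z 0 * y 0)) + c 1 * (z 1 * σ (z 1))⁻¹ * (β - 1) * ((z 1 * y 1) * σ (z 1 * y 1)) =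
          c 0 * (α - 1) * (y 0 * σ (y 0)) + c 1 * (β - 1) * (y 1 * σ (y 1)) := by
        have hz0' := hz 0; have hz1' := hz 1; have hs0 := hσz 0; have hs1 := hσz 1
        rw [map_mul, map_mul]
        field_simp
      rw [hZ]
      simp only [Matrix.mulVec_diagonal]
      rw [key]
      exact hP

/-! ## §2  The model form: a clean-shell vertex of the diagonal model is one-class -/

/-- **(A″) IN THE DIAGONAL MODEL, `d ≥ 2`.**  Ramified quadratic datum with `2 ≤ d`; `diag(c)` non-degenerate and `σ`-fixed; an element datum `(α, β)` with threshold
`N₀ ≥ 2⌊(m* + d)∕2⌋ = m_c`; `M` a type-0 vertex of `diag(c)` fixed by `T = diag(α, β, 1)` on the clean shell (`X·M ⊆ ϖ^{ℓ₀}M`, `⊄ ϖ^{ℓ₀+1}M`, `X²·M ⊆ ϖ^{m_c}M`, `ℓ₀ = d % 2`).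
Then the model value set at precision `m* = mstarOfRecord d` equals `valueSetMod σ ϖ m* (e • X₊)` for a `σ`-fixed unit `e`.
[cite: Rogawski1990, §4.9 Prop. 4.9.1 (b) p. 55] [cite: Kottwitz1986BaseChangeUnits, §1 pp. 240–241] [cite: Jacobowitz1962, §4, §7] -/
theorem exists_class_of_clean_shell_model {σ : K →+* K} {ϖ : K} {d t : ℕ} (hDat : IsRamifiedQuadraticDatum σ ϖ d t) (h2d : 2 ≤ d)
    {c : Fin 3 → K} (hcσ : ∀ i, σ (c i) = c i) (hc0 : ∀ i, c i ≠ 0)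
    {α β : K} {N₀ n₁ n₂ n₃ : ℕ} (hE : IsElementDatum σ ϖ N₀ α β n₁ n₂ n₃) (hN₀ : 2 * ((mstarOfRecord d + d) / 2) ≤ N₀)
    {T : GL (Fin 3) K} (hT : (T : Matrix (Fin 3) (Fin 3) K) = Matrix.diagonal ![α, β, 1])
    {M : Submodule 𝒪[K] (Fin 3 → K)} (hM : IsVertexLattice σ ϖ (Matrix.diagonal c) 0 M) (hTM : mapGL T M = M)
    (hlev : LatticeInLevel ϖ (d % 2) (Matrix.diagonal ![α - 1, β - 1, 0]) M) (hnlev : ¬ LatticeInLevel ϖ (d % 2 + 1) (Matrix.diagonal ![α - 1, β - 1, 0]) M)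
    (hsq : LatticeInLevel ϖ (2 * ((mstarOfRecord d + d) / 2)) (Matrix.diagonal ![(α - 1) * (α - 1), (β - 1) * (β - 1), 0]) M) :
    ∃ e : K, σ e = e ∧ Valued.v e = 1 ∧
      {v | ∃ y ∈ M, Valued.v ((ϖ ^ mstarOfRecord d)⁻¹ * (v - (c 0 * (α - 1) * (y 0 * σ (y 0)) + c 1 * (β - 1) * (y 1 * σ (y 1))))) ≤ 1} =
        valueSetMod σ ϖ (mstarOfRecord d) (e • xPlus σ ϖ d) := by
  obtain ⟨hσ, hvσ, hϖ, hfix, hd, h1d, ht⟩ := id hDat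
  have hϖ0 : ϖ ≠ 0 := (Valuation.ne_zero_iff Valued.v).1 (by rw [hϖ]; exact exp_ne_zero)
  -- ### (1) normalise `M` by a diagonal `ϖ`-power `Z`
  obtain ⟨g, hMg, -, -, -⟩ := id hM
  obtain ⟨a, ha, -⟩ := existsUnique_zpow_diagonal_normalised hϖ g
  obtain ⟨Z, hZ⟩ := exists_gl_coe_eq_diagonal_zpow (N := 3) hϖ0 a
  have hz0 : ∀ i, (fun i => ϖ ^ (a i)) i ≠ 0 := fun i => zpow_ne_zero _ hϖ0
  have hn : IsNormalisedLattice (mapGL Z M) := by rw [hMg]; exact ha Z hZ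
  -- ### (2) present the normalised lattice in HNF
  have hZM : mapGL Z M = latt ((Z * g : GL (Fin 3) K) : Matrix (Fin 3) (Fin 3) K) := by rw [hMg, mapGL_latt]
  have hle : latt ((Z * g : GL (Fin 3) K) : Matrix (Fin 3) (Fin 3) K) ≤ stdLattice K 3 := fun w hw => mem_stdLattice.2 fun i => (hn i).1 w (hZM ▸ hw)
  obtain ⟨b, cc, x, y, z, hx, hy, hz, hV⟩ := exists_latt_eq_latt_hnf hϖ (Z * g) hle (by rw [← hZM]; exact (hn 0).2)
  rw [hV] at hZM
  -- ### (3) the translated polarisation `D`, stability and the level tokens on `Z·M = latt V`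
  set D : Fin 3 → K := fun i => c i * ((fun i => ϖ ^ (a i)) i * σ ((fun i => ϖ ^ (a i)) i))⁻¹ with hDdef
  have hDσ : ∀ i, σ (D i) = D i := fun i => by
    simp only [hDdef, map_mul, map_inv₀, hσ, hcσ i, mul_comm (σ (ϖ ^ a i)) (ϖ ^ a i)]
  have hD0 : ∀ i, D i ≠ 0 := fun i => mul_ne_zero (hc0 i) (inv_ne_zero (mul_ne_zero (hz0 i) ((map_ne_zero σ).2 (hz0 i))))
  have hMn : IsVertexLattice σ ϖ (Matrix.diagonal D) 0 (latt (Matrix.of ![![1, 0, 0], ![x, ϖ ^ b, 0], ![y, z, ϖ ^ cc]])) := by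
    rw [← hZM]; exact isVertexLattice_diagonal_mapGL_diagonal σ ϖ c _ hz0 Z hZ hM
  have hZT : Z * T * Z⁻¹ = T := Units.ext (by rw [Units.val_mul, Units.val_mul, hT, diagonal_conj_diagonal hZ])
  have hTn : mapGL T (latt (Matrix.of ![![1, 0, 0], ![x, ϖ ^ b, 0], ![y, z, ϖ ^ cc]])) = latt (Matrix.of ![![1, 0, 0], ![x, ϖ ^ b, 0], ![y, z, ϖ ^ cc]]) := by
    rw [← hZM]
    have h := (mapGL_conj_mapGL_eq_iff Z T M).2 hTM
    rwa [hZT] at h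
  have hlevn : LatticeInLevel ϖ (d % 2) (Matrix.diagonal ![α - 1, β - 1, 0]) (latt (Matrix.of ![![1, 0, 0], ![x, ϖ ^ b, 0], ![y, z, ϖ ^ cc]])) := by
    rw [← hZM]; exact (latticeInLevel_diagonal_mapGL_iff hZ ϖ _ _ M).2 hlev
  have hnlevn : ¬ LatticeInLevel ϖ (d % 2 + 1) (Matrix.diagonal ![α - 1, β - 1, 0]) (latt (Matrix.of ![![1, 0, 0], ![x, ϖ ^ b, 0], ![y, z, ϖ ^ cc]])) := by
    rw [← hZM]; exact fun h => hnlev ((latticeInLevel_diagonal_mapGL_iff hZ ϖ _ _ M).1 h)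
  have hsqn : LatticeInLevel ϖ (2 * ((mstarOfRecord d + d) / 2)) (Matrix.diagonal ![(α - 1) * (α - 1), (β - 1) * (β - 1), 0])
      (latt (Matrix.of ![![1, 0, 0], ![x, ϖ ^ b, 0], ![y, z, ϖ ^ cc]])) := by
    rw [← hZM]; exact (latticeInLevel_diagonal_mapGL_iff hZ ϖ _ _ M).2 hsq
  -- ### (4) the S-diagonal generating triple (★ (L-lab-17c)) and the class (★ (L-lab-16)) on `latt V`
  have hm : mstarOfRecord d = d % 2 + 2 * d - 1 := rfl
  obtain ⟨hα, hβ, -⟩ := id hE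
  obtain ⟨y₁, y₂, y₃, hy₁, hy₂, hy₃0, hy₃1, hgen, h12, hs₁, hs₂⟩ :=
    exists_triple_of_clean_shell_latt_hnf hDat hDσ hD0 hx hy hz (hZM ▸ hn) hMn hE (ℓ := d % 2) (m := mstarOfRecord d) (mc := 2 * ((mstarOfRecord d + d) / 2))
      (by omega) (by omega) (by omega) (by omega) hlevn hnlevn hsqn
  obtain ⟨e, hσe, he1, hset⟩ := exists_class_setOf_modelValue_eq_of_triple_of_isVertexLattice hσ hvσ hfix hϖ hd ht hD0 (hDσ 0) (hDσ 1) hα hβ hMn hT hTn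
    (m := mstarOfRecord d) (mc := 2 * ((mstarOfRecord d + d) / 2)) h1d (by omega) (by omega) hsqn hy₁ hy₂ hy₃0 hy₃1 hgen h12 (by rw [hs₁, map_pow]) hs₂
  refine ⟨e, hσe, he1, ?_⟩
  -- ### (5) transport the value set back along `Z`
  rw [← hset, ← hZM]
  ext v
  simp only [Set.mem_setOf_eq]
  exact (exists_mem_mapGL_diagonal_modelValue_iff σ hz0 Z hZ c α β M (fun w => Valued.v ((ϖ ^ mstarOfRecord d)⁻¹ * (v - w)) ≤ 1)).symm

/-! ## §3  HEAD — (A″) at the record letters -/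

/-- **(A″) ABOVE THE FENCE, `d ≥ 2`**: `CleanLabelDichotomyLawAt N₀ mcOfRecord σ ϖ d t` whenever `mcOfRecord d ≤ N₀ d` — on every type-(1) four-frame family at an element datum above
`N₀ d`, every `Γ_b`-fixed type-0 vertex on the clean shell `(d % 2, m_c)` has the `ϖ^{m*}`-thickened value set of `e • X₊` for a `σ`-fixed unit `e`.  Proof: ★ p855032's unimodular
diagonal frame `A` (`Γ_b = A·diag(α,β,1)·A⁻¹`, `ᵗσ(A)Φ₃A = diag(c)`) transports vertex, fixedness, shell tokens and the value set (★ p858764, ★ p859223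
`latticeValueSetMod_conj_mapGL_eq`) to the model, where §2 applies. [cite: Rogawski1990, §4.9 Prop. 4.9.1 (b) p. 55] [cite: Kottwitz1986BaseChangeUnits, §1 pp. 240–241] -/
theorem cleanLabelDichotomyLawAt_of_fence [CompleteSpace K] [Fintype (Valued.ResidueField K)] (N₀ : ℕ → ℕ) (σ : K →+* K) (ϖ : K) {d : ℕ} (t : ℕ)
    (h2d : 2 ≤ d) (hN : mcOfRecord d ≤ N₀ d) : CleanLabelDichotomyLawAt N₀ mcOfRecord σ ϖ d t := by
  intro hD f hf α β n₁ n₂ n₃ hE Γ hΓ b M hM hfix hshell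
  obtain ⟨hσ, hvσ, hϖ, heven, -, -, -⟩ := id hD
  -- the unimodular diagonal model of frame `b`
  obtain ⟨A, c, hc, hσc, -, hA, hconj⟩ := exists_unimodular_diagonal_frame hσ hvσ hϖ heven hf b
  set T : GL (Fin 3) K := A⁻¹ * Γ b * A with hTdef
  have hΓT : Γ b = A * T * A⁻¹ := by rw [hTdef]; group
  have hT : (T : Matrix (Fin 3) (Fin 3) K) = Matrix.diagonal ![α, β, 1] := by
    rw [hTdef, Units.val_mul, Units.val_mul, hΓ b, hconj α β, ← Matrix.mul_assoc, ← Matrix.mul_assoc, Units.inv_mul, Matrix.one_mul,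
      Matrix.mul_assoc, Units.inv_mul, Matrix.mul_one]
  have hM' : mapGL A (mapGL A⁻¹ M) = M := mapGL_mapGL_inv A M
  have hv' : IsVertexLattice σ ϖ (Matrix.diagonal c) 0 (mapGL A⁻¹ M) := by
    rw [← hA, isVertexLattice_formCongr_iff, hM']; exact hM
  have hfix' : mapGL T (mapGL A⁻¹ M) = mapGL A⁻¹ M := by
    rw [← mapGL_conj_mapGL_eq_iff A, hM', ← hΓT]; exact hfix
  have hX : (Γ b : Matrix (Fin 3) (Fin 3) K) - 1 =
      (A : Matrix (Fin 3) (Fin 3) K) * Matrix.diagonal ![α - 1, β - 1, 0] * ((A⁻¹ : GL (Fin 3) K) : Matrix (Fin 3) (Fin 3) K) := by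
    rw [hΓT, F0P3cDyRamLevelCountDiagonalModel.coe_conj_sub_one, hT, diagonal_three_sub_one, sub_self]
  have hX2 : ((Γ b : Matrix (Fin 3) (Fin 3) K) - 1) * ((Γ b : Matrix (Fin 3) (Fin 3) K) - 1) =
      (A : Matrix (Fin 3) (Fin 3) K) * Matrix.diagonal ![(α - 1) * (α - 1), (β - 1) * (β - 1), 0] * ((A⁻¹ : GL (Fin 3) K) : Matrix (Fin 3) (Fin 3) K) := by
    rw [hΓT, coe_conj_sub_one_mul_self, hT, diagonal_three_sub_one_mul_self, sub_self, mul_zero]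
  -- the shell tokens in the model
  obtain ⟨hlev', hnlev', hsq'⟩ := hshell
  rw [hX, ← hM', latticeInLevel_conj_mapGL_iff] at hlev' hnlev'
  rw [hX2, ← hM', latticeInLevel_conj_mapGL_iff] at hsq'
  -- §2 in the model
  have hmc : mcOfRecord d = 2 * ((mstarOfRecord d + d) / 2) := rfl
  obtain ⟨e, hσe, he1, hset⟩ := exists_class_of_clean_shell_model hD h2d hσc (fun i => (Valuation.ne_zero_iff Valued.v).1 (by rw [hc i]; exact one_ne_zero))
    hE (hmc ▸ hN) hT hv' hfix' hlev' hnlev' (hmc ▸ hsq')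
  refine ⟨e, hσe, he1, ?_⟩
  rw [← hset, hX, ← hM', latticeValueSetMod_conj_mapGL_eq, hA, hM']
  simp only [pairing_diagonal_mulVec_diagonal_three]

/-- **(A″) AT THE DERIVED THRESHOLD, EVERY DYADIC `d`**: `2 ≤ d → CleanLabelDichotomyLawAt n0DerivedOfRecord mcOfRecord σ ϖ d t` (★ №6 `mcOfRecord_le_n0DerivedOfRecord`).
[cite: Rogawski1990, §4.9 Prop. 4.9.1 (b) p. 55] [cite: Kottwitz1986BaseChangeUnits, §1 pp. 240–241] -/
theorem cleanLabelDichotomyLawAt_derived [CompleteSpace K] [Fintype (Valued.ResidueField K)] (σ : K →+* K) (ϖ : K) {d : ℕ} (t : ℕ) (h2d : 2 ≤ d) :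
    CleanLabelDichotomyLawAt n0DerivedOfRecord mcOfRecord σ ϖ d t :=
  cleanLabelDichotomyLawAt_of_fence n0DerivedOfRecord σ ϖ t h2d (mcOfRecord_le_n0DerivedOfRecord d)

/-- **THE TIER-0 SHAPE OF (A″)**: `∀ σ ϖ d t, DyadicFence (CleanLabelDichotomyLawAt n0DerivedOfRecord mcOfRecord σ ϖ d t)` — the fence `|2| < 1` makes the datum dyadic, hence `d ≥ 2`
(★ `two_le_d_of_v_two_lt_one`), and §3 applies; at the tame class `d = 1` the unfenced Prop is false (label-neither clean-shell vertices at `sqlev = m_c`), so the guard is sharp.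
[cite: Rogawski1990, §4.9 Prop. 4.9.1 (b) p. 55] [cite: Kottwitz1986BaseChangeUnits, §1 pp. 240–241] -/
theorem dyadicFence_cleanLabelDichotomyLawAt_derived_ofRecord :
    ∀ {K : Type} [Field K] [Valued K ℤᵐ⁰] [CompleteSpace K] [Fintype (Valued.ResidueField K)] (σ : K →+* K) (ϖ : K) (d t : ℕ),
      DyadicFence (K := K) (CleanLabelDichotomyLawAt n0DerivedOfRecord mcOfRecord σ ϖ d t) :=
  fun σ ϖ _ t h2 hD => cleanLabelDichotomyLawAt_derived σ ϖ t (two_le_d_of_v_two_lt_one hD h2) hD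

end Summit.HodgeConjecture.HodgeConjecture.Cruxes.H413.F0P3cDyRamCleanLabelDichotomyOfRecord

end
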